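/-
Copyright (c) 2026 the pub-hodgecm-mathlib formalisation cell (harness21).  Prover seat hodgecm-mathlib-LH4-p07 (g4), req620 Track A «(D-RAM) FOUR-FRAME» squad
(heir LEAD F0P3a-plan lineage; dealer LH4-plan lineage WORD #26 (1); MS ROAD A, Stage B₂ brick B7₂ (iv)₂ «CORE-HANGING STRATA, TYPE 2 — THE WEIGHTED COUNT», FILE (C₂):
the TUBE REGIME; Stage B lead LH4-p10 (g2); re-keyed on multiplicity by LH4-p11 (g2) 2026-09-04T00:53Z).  2026-09-04.
-/
import Summits.HodgeConjecture.HodgeConjecture.Theorems.F0P3cDyRamDiagonalCoreHangingPolarisationCountTypeTwo   -- (iii)₂ (b) (this seat): `polarisationCount` by value; brings (A)(B)(ii)₂(iii)₂(a), ★ PolarisationCountTools (`finsum_mem_mul_eq_of_forall_eq`), ★ Corner indices, ★ class reps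
import Summits.HodgeConjecture.HodgeConjecture.Theorems.F0P3cDyRamDiagonalCoreHangingCount                      -- ★ p856098 (this seat's g3, B7 (iv) (C)): the type-0 template; brings ★ `…CoreHangingOrbits` (`exists_coreHanging_of_mem_orbit`, `fixed_kappa_unit_letters`, …), ★ `…CoreHangingClasses` (`ncard_admissible_representatives_eq`), ★ StratumTools
import Summits.HodgeConjecture.HodgeConjecture.Theorems.F0P3cDyRamDiagonalGluedBoxCountCorner                   -- ★ p856249 (F0P3-p01): `exists_mem_unitTorus_latt_glued_corner_eq_mapGL`, `criterionR_iff_exists_fixed_kappa`, `v_kappa_sub_le_of_latt_glued_corner_eq`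
import Summits.HodgeConjecture.HodgeConjecture.Theorems.F0P3cDyRamDiagonalGluedStabiliserIndexFullCorner         -- ★ p856228 (F0P3-p01): `ncard_unitTorus_orbit_latt_glued_typeTwo_eq`
import Summits.HodgeConjecture.HodgeConjecture.Theorems.F0P3cDyRamDiagonalGluedStabilityCorner                   -- ★ p856218-chain (F0P3-p01): `mapGL_latt_hnf_glued_typeTwo_eq_of_depths`
import HarnessLib

/-!
# Crux `H413`, MS ROAD A, STAGE B₂ brick B7₂ (iv)₂, FILE (C₂): the n₂-WEIGHTED COUNT of the CORE-HANGING TYPE-2 stratum `H(2ρ+1)` in the TUBE REGIME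
# `2ρ+1 ≤ n₁, n₂`, `ρ ≤ n₃`:  `∑ᶠ_{M ∈ 𝒮_H₂(ρ)} n₂(M)∕[𝒰 : S_F(M)] = (q − 2)·q^{2ρ}` (the tube summand of the re-keyed `stub_B7_H`)

Cell `hodgecm-mathlib` (D-0151), FLOOR 0, crux item H413 = `stmt-HodgeConjecture-24833`; lane `--supports stmt-HodgeConjecture-24833 --as helper` (count-neutral).  THEOREMS ONLY
(no `def`, no instance, no notation, no `sorry`, default heartbeats).
THE STRATUM.  `𝒮_H₂(ρ) := {M ∈ 𝓛₀(T) ∣ M type-2 polarisable ∧ ∃ x ζ y″ (|x| = |ζ| = |y″| = |xζ + y″| = 1), M = latt V_H₂(x, ζ, y″)}`, `V_H₂(x,ζ,y″) = (1 0 0; x ϖ^ρ 0; xζ+y″ ϖ^ρζ ϖ^{2ρ+1})`,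
for `T = diag(α, β, 1)` with unit entries and depths `|β − 1| = |ϖ|^{n₁}`, `|α − 1| = |ϖ|^{n₂}`, `|β − α| = |ϖ|^{n₃}`; the weight is `n₂(M)·w(M)`, `n₂ = polarisationCount σ ϖ 2`
(LH4-p11 (g2)'s re-key 2026-09-04T00:53Z), `w = stabiliserWeight σ = 1∕[𝒰 : S_F]`.
THE MATHEMATICS (orbit–stabiliser, the type-0 template ★ p856098 with the corner one larger and the multiplicity).  In the tube regime every `V_H₂`-lattice is `T`-stable (★
`mapGL_latt_hnf_glued_typeTwo_eq_of_depths` at `s = 0`) and normalised; type-2 polarisable ⟺ (R) ((B) ★ p856430) ⟺ the class of `κ = y″∕(xζ)` modulo `𝔭^ρ` is `F`-rational (★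
`criterionR_iff_exists_fixed_kappa`), so `𝒮_H₂(ρ) = ⨆_{g ∈ R_adm} 𝒯·latt V_H₂(1,1,g)` over the ADMISSIBLE representatives `R_adm = {g ∈ R : |1 + g| = 1}` of the fixed units modulo `𝔭^ρ`
(`#R_adm = (q−2)·q^{⌈ρ∕2⌉−1}`, ★ `ncard_admissible_representatives_eq`), disjointly (`κ` mod `𝔭^ρ` is a lattice invariant, ★ `v_kappa_sub_le_of_latt_glued_corner_eq`).  On the set,
`n₂ ≡ q^{(ρ+2)∕2 − (ρ+1)∕2}` ((iii)₂ (b)); each orbit has `[𝒯 : S̃] = ((q−1)q^ρ)((q−1)q^{2ρ})` members (★ `ncard_unitTorus_orbit_latt_glued_typeTwo_eq`, `s = 0`) of weight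
`1∕[𝒰 : S_F] = (((q−1)q^{(ρ+2)∕2−1})((q−1)q^ρ))⁻¹` (★ `stabiliserWeight_latt_glued_typeTwo_eq`, `s = 0`); with `(ρ+2)∕2 − 1 = ((ρ+1)∕2 − 1) + ((ρ+2)∕2 − (ρ+1)∕2)` the product is
`(q − 2)·q^{2ρ}` for BOTH parities of `ρ` (LH4-r01 (g3) DX ∕ REF5 R5-81 (A) ∕ LH4-p10 (g2) 01:03:42Z: `H(3) = 32 = 2·4²` at q = 4 ✓).
* §1 `isNormalisedLattice_latt_coreHangingTwo`, `isTypeTwoPolarisable_latt_coreHangingTwo_iff_exists_fixed_kappa`, `coreHangingTwoStratum_eq_iUnion_orbits`,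
  `pairwise_disjoint_orbits_two`, `finsum_stabiliserWeight_orbit_two_eq`, `polarisationCount_eq_of_mem_coreHangingTwoStratum`.
* §2 HEAD **`finsum_polarisationCount_mul_stabiliserWeight_coreHangingTwoStratum_tube`**.
HONEST LABEL.  Count-neutral; the census laws stay PROVER TARGETS until the MS assembly lands; `HC_CM` is proved only modulo the 7 printed citations (2 remaining named inputs:
hLiu418 = `stmt-HodgeConjecture-24832`, h413 = `stmt-HodgeConjecture-24833`) until rung 0 closes.

## References
* [Kottwitz1986BaseChangeUnits] R. Kottwitz, *Base change for unit elements of Hecke algebras*, Compositio Math. 60 (1986), §1 pp. 240–241 (lattice counts via torus orbits).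
* [Rogawski1990] J. D. Rogawski, *Automorphic Representations of Unitary Groups in Three Variables*, Ann. of Math. Stud. 123 (1990), §4.9 Prop. 4.9.1 (a) p. 55.
* [Serre1980Trees] J.-P. Serre, *Trees*, Springer (1980), Ch. II §1.1 (lattices `g·𝒪^N`, Hermite normal forms).
-/

set_option autoImplicit false

noncomputable section

namespace Summit.HodgeConjecture.HodgeConjecture.Cruxes.H413.F0P3cDyRamDiagonalCoreHangingCountTypeTwo

open Matrix
open Literature.NumberTheory.Automorphic Literature.NumberTheory.Automorphic.HermitianLattice
open Literature.NumberTheory.Automorphic.UnitaryLatticeTree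
open Summit.HodgeConjecture.HodgeConjecture.Cruxes.H413.F0P3cDyRamDiagonalTorusDefs
open Summit.HodgeConjecture.HodgeConjecture.Cruxes.H413.F0P3cDyRamDiagonalStrataDefs
open Summit.HodgeConjecture.HodgeConjecture.Cruxes.H413.F0P3cDyRamDiagonalGluedTorusOrbits
open Summit.HodgeConjecture.HodgeConjecture.Cruxes.H413.F0P3cDyRamDiagonalCoreHangingOrbits
open Summit.HodgeConjecture.HodgeConjecture.Cruxes.H413.F0P3cDyRamDiagonalCoreHangingClasses
open Summit.HodgeConjecture.HodgeConjecture.Cruxes.H413.F0P3cDyRamDiagonalCoreHangingCount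
open Summit.HodgeConjecture.HodgeConjecture.Cruxes.H413.F0P3cDyRamDiagonalGluedClassRepresentatives
open Summit.HodgeConjecture.HodgeConjecture.Cruxes.H413.F0P3cDyRamDiagonalGluedStabiliserIndex
open Summit.HodgeConjecture.HodgeConjecture.Cruxes.H413.F0P3cDyRamDiagonalGluedStabiliserIndexCorner
open Summit.HodgeConjecture.HodgeConjecture.Cruxes.H413.F0P3cDyRamDiagonalGluedStabiliserIndexFullCorner
open Summit.HodgeConjecture.HodgeConjecture.Cruxes.H413.F0P3cDyRamDiagonalGluedStabilityCorner
open Summit.HodgeConjecture.HodgeConjecture.Cruxes.H413.F0P3cDyRamDiagonalGluedBoxCountCorner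
open Summit.HodgeConjecture.HodgeConjecture.Cruxes.H413.F0P3cDyRamDiagonalStratumTools
open Summit.HodgeConjecture.HodgeConjecture.Cruxes.H413.F0P3cDyRamDiagonalPolarisationCountTools
open Summit.HodgeConjecture.HodgeConjecture.Cruxes.H413.F0P3cDyRamDiagonalCoreHangingCriterionTypeTwo
open Summit.HodgeConjecture.HodgeConjecture.Cruxes.H413.F0P3cDyRamDiagonalFixedClassRefinementCount
open Summit.HodgeConjecture.HodgeConjecture.Cruxes.H413.F0P3cDyRamDiagonalCoreHangingPolarisationCountTypeTwo
open scoped Valued WithZero Matrix MatrixGroups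

variable {K : Type*} [Field K] [Valued K ℤᵐ⁰]

/-! ## §1 The stratum is a disjoint union of unit-torus orbits indexed by the admissible representatives; the weights -/

/-- Every core-hanging type-2 frame lattice is NORMALISED (rows contain the units `1`, `x`, `xζ + y″`; all entries integral). [cite: Serre1980Trees, Ch. II §1.1] -/
theorem isNormalisedLattice_latt_coreHangingTwo {ϖ : K} (hϖ1 : Valued.v ϖ ≤ 1) (ρ : ℕ) {x ζ y'' : K} (hx : Valued.v x = 1) (hζ : Valued.v ζ = 1)
    (hy : Valued.v (x * ζ + y'') = 1) :
    IsNormalisedLattice (latt (!![1, 0, 0; x, ϖ ^ ρ, 0; x * ζ + y'', ϖ ^ ρ * ζ, ϖ ^ (2 * ρ + 1)] : Matrix (Fin 3) (Fin 3) K)) := by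
  have hp : Valued.v (ϖ ^ ρ) ≤ 1 := by rw [map_pow]; exact pow_le_one₀ zero_le hϖ1
  have hr : Valued.v (ϖ ^ (2 * ρ + 1)) ≤ 1 := by rw [map_pow]; exact pow_le_one₀ zero_le hϖ1
  have hz : Valued.v (ϖ ^ ρ * ζ) ≤ 1 := by rw [map_mul, hζ, mul_one]; exact hp
  exact (F0P3cDyRamDiagonalStableLatticeHNF.normalised_latt_hnf_iff hx.le hy.le hz hp hr).2 ⟨Or.inr hx, Or.inr (Or.inl hy)⟩

/-- **(R) IN `κ`-CURRENCY, TYPE 2**: the core-hanging type-2 frame lattice is type-2 polarisable iff the class of `κ = y″∕(xζ)` modulo `𝔭^ρ` contains a `σ`-fixed element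
((B) ★ p856430 `isTypeTwoPolarisable_latt_hnf_coreHanging_iff` + ★ `criterionR_iff_exists_fixed_kappa`). [cite: Kottwitz1986BaseChangeUnits, §1 pp. 240–241] -/
theorem isTypeTwoPolarisable_latt_coreHangingTwo_iff_exists_fixed_kappa {σ : K →+* K} (hσ : ∀ a, σ (σ a) = a) (hvσ : ∀ a, Valued.v (σ a) = Valued.v a)
    {ϖ : K} (hϖ0 : ϖ ≠ 0) (hϖ1 : Valued.v ϖ < 1) (hTr : ∀ a : K, Valued.v (a + σ a) ≤ Valued.v ϖ * Valued.v a)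
    (ρ : ℕ) (hρ : 1 ≤ ρ) {x ζ y'' : K} (hx : Valued.v x = 1) (hζ : Valued.v ζ = 1) (hy'' : Valued.v y'' = 1) (hy : Valued.v (x * ζ + y'') = 1)
    (V : GL (Fin 3) K) (hV : (V : Matrix (Fin 3) (Fin 3) K) = !![1, 0, 0; x, ϖ ^ ρ, 0; x * ζ + y'', ϖ ^ ρ * ζ, ϖ ^ (2 * ρ + 1)]) :
    IsTypeTwoPolarisable σ ϖ (latt (V : Matrix (Fin 3) (Fin 3) K)) ↔ ∃ f : K, σ f = f ∧ Valued.v (y'' / (x * ζ) - f) ≤ Valued.v ϖ ^ ρ := by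
  rw [isTypeTwoPolarisable_latt_hnf_coreHanging_iff hσ hvσ hϖ0 hϖ1 hTr ρ hρ hx hζ hy'' hy V hV]
  exact criterionR_iff_exists_fixed_kappa hσ hvσ hx hζ y'' _

/-- **THE TUBE-REGIME DECOMPOSITION OF THE CORE-HANGING TYPE-2 STRATUM INTO `𝒯`-ORBITS.**  Datum letters `hσ hvσ`, `ϖ` a uniformiser with the wild trace bound,
`T = diag(α, β, 1)` with unit entries and depths `n₁ n₂ n₃`, TUBE hypotheses `2ρ+1 ≤ n₁`, `2ρ+1 ≤ n₂`, `ρ ≤ n₃` (`ρ ≥ 1`); `R` any complete irredundant system of `σ`-fixed units modulo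
`𝔭^ρ`.  Then `𝒮_H₂(ρ) = ⋃_{g ∈ R, |1+g| = 1} 𝒯·latt V_H₂(1, 1, g)`. [cite: Kottwitz1986BaseChangeUnits, §1 pp. 240–241] [cite: Rogawski1990, §4.9 Prop. 4.9.1 (a) p. 55] -/
theorem coreHangingTwoStratum_eq_iUnion_orbits {σ : K →+* K} (hσ : ∀ a, σ (σ a) = a) (hvσ : ∀ a, Valued.v (σ a) = Valued.v a)
    {ϖ : K} (hϖ : Valued.v ϖ = WithZero.exp (-1 : ℤ)) (hTr : ∀ a : K, Valued.v (a + σ a) ≤ Valued.v ϖ * Valued.v a)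
    (T : GL (Fin 3) K) {α β : K} (hT : (T : Matrix (Fin 3) (Fin 3) K) = Matrix.diagonal ![α, β, 1]) (hα : Valued.v α = 1) (hβ : Valued.v β = 1)
    {n₁ n₂ n₃ : ℕ} (h₁ : Valued.v (β - 1) = Valued.v ϖ ^ n₁) (h₂ : Valued.v (α - 1) = Valued.v ϖ ^ n₂) (h₃ : Valued.v (β - α) = Valued.v ϖ ^ n₃)
    {ρ : ℕ} (hρ : 1 ≤ ρ) (hρ₁ : 2 * ρ + 1 ≤ n₁) (hρ₂ : 2 * ρ + 1 ≤ n₂) (hρ₃ : ρ ≤ n₃)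
    {R : Set K} (hR1 : ∀ g ∈ R, σ g = g ∧ Valued.v g = 1) (hR2 : ∀ f : K, σ f = f → Valued.v f = 1 → ∃ g ∈ R, Valued.v (f - g) ≤ Valued.v ϖ ^ ρ) :
    {M : Submodule 𝒪[K] (Fin 3 → K) | M ∈ normalisedStableLattices T ∧ IsTypeTwoPolarisable σ ϖ M ∧
        ∃ x ζ y'' : K, Valued.v x = 1 ∧ Valued.v ζ = 1 ∧ Valued.v y'' = 1 ∧ Valued.v (x * ζ + y'') = 1 ∧
          M = latt (!![1, 0, 0; x, ϖ ^ ρ, 0; x * ζ + y'', ϖ ^ ρ * ζ, ϖ ^ (2 * ρ + 1)] : Matrix (Fin 3) (Fin 3) K)} =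
      ⋃ g ∈ {g : K | g ∈ R ∧ Valued.v (1 + g) = 1},
        {M | ∃ u ∈ unitTorus K 3, M = mapGL (diagGLUnits u) (latt (!![1, 0, 0; 1, ϖ ^ ρ, 0; 1 * 1 + g, ϖ ^ ρ * 1, ϖ ^ (2 * ρ + 1)] : Matrix (Fin 3) (Fin 3) K))} := by
  obtain ⟨hϖ0, hϖ1⟩ := ne_zero_and_v_lt_one_of_v_eq_exp hϖ
  have hpρ : ϖ ^ ρ ≠ 0 := pow_ne_zero _ hϖ0
  have hpr : ϖ ^ (2 * ρ + 1) ≠ 0 := pow_ne_zero _ hϖ0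
  ext M
  simp only [Set.mem_setOf_eq, Set.mem_iUnion, exists_prop]
  constructor
  · rintro ⟨-, hpol, x, ζ, y'', hx, hζ, hy'', hy, rfl⟩
    obtain ⟨V, hV⟩ := exists_gl_coe_eq_glued x ζ y'' hpρ hpr
    rw [← hV] at hpol
    obtain ⟨f, hσf, hκf⟩ := (isTypeTwoPolarisable_latt_coreHangingTwo_iff_exists_fixed_kappa hσ hvσ hϖ0 hϖ1 hTr ρ hρ hx hζ hy'' hy V hV).1 hpol
    obtain ⟨hvf, -⟩ := fixed_kappa_unit_letters hϖ1 hρ hx hζ hy'' hy hκf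
    obtain ⟨g, hgR, hfg⟩ := hR2 f hσf hvf
    have hκg : Valued.v (y'' / (x * ζ) - g) ≤ Valued.v ϖ ^ ρ := by
      have e : y'' / (x * ζ) - g = (y'' / (x * ζ) - f) + (f - g) := by ring
      rw [e]; exact Valuation.map_add_le _ hκf hfg
    have h1g : Valued.v (1 + g) = 1 :=
      v_one_add_eq_one_of_near (v_one_add_kappa_eq_one hx hζ hy) (hκg.trans_lt (v_pow_lt_one hϖ1 hρ))
    obtain ⟨V₀, hV₀⟩ := exists_gl_coe_eq_glued (1 : K) 1 g hpρ hpr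
    have hy''0 : Valued.v y'' = Valued.v ϖ ^ 0 := by rw [pow_zero]; exact hy''
    have hg0 : Valued.v g = Valued.v ϖ ^ 0 := by rw [pow_zero]; exact (hR1 g hgR).2
    have hκg0 : Valued.v (y'' / (x * ζ) - g) ≤ Valued.v ϖ ^ (ρ + 0) := by rw [Nat.add_zero]; exact hκg
    obtain ⟨u, hu, hM⟩ := exists_mem_unitTorus_latt_glued_corner_eq_mapGL hϖ0 ρ 0 hx hζ hy''0 hg0 hκg0 hpr V₀ hV₀
    exact ⟨g, ⟨hgR, h1g⟩, u, hu, by rw [hM, hV₀]⟩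
  · rintro ⟨g, ⟨hgR, h1g⟩, u, hu, rfl⟩
    obtain ⟨hσg, hvg⟩ := hR1 g hgR
    obtain ⟨V₀, hV₀⟩ := exists_gl_coe_eq_glued (1 : K) 1 g hpρ hpr
    obtain ⟨x', ζ', y₁, hx', hζ', hy₁, hy', hκ, hM⟩ := exists_coreHanging_of_mem_orbit u hu hvg h1g (ϖ ^ ρ) (ϖ ^ (2 * ρ + 1)) V₀ hV₀
    rw [← hV₀, hM]
    obtain ⟨V, hV⟩ := exists_gl_coe_eq_glued x' ζ' y₁ hpρ hpr
    refine ⟨⟨⟨V, by rw [hV]⟩, ?_, isNormalisedLattice_latt_coreHangingTwo hϖ1.le ρ hx' hζ' hy'⟩, ?_, x', ζ', y₁, hx', hζ', hy₁, hy', rfl⟩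
    · -- `T`-stable: the tube (★ at `s = 0`)
      have hV0 : (V : Matrix (Fin 3) (Fin 3) K) = !![1, 0, 0; x', ϖ ^ ρ, 0; x' * ζ' + y₁, ϖ ^ ρ * ζ', ϖ ^ (2 * ρ + 1 + 0)] := by rw [Nat.add_zero]; exact hV
      have h := mapGL_latt_hnf_glued_typeTwo_eq_of_depths hϖ0 hϖ1.le hα hβ T hT h₁ h₂ h₃ ρ 0 (by omega) hρ₂ hρ₃ hx' hζ' (by rw [pow_zero]; exact hy₁) V hV0
      rwa [hV] at h
    · -- polarisable: the class of `κ = g` is `F`-rational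
      rw [← hV]
      exact (isTypeTwoPolarisable_latt_coreHangingTwo_iff_exists_fixed_kappa hσ hvσ hϖ0 hϖ1 hTr ρ hρ hx' hζ' hy₁ hy' V hV).2
        ⟨g, hσg, by rw [hκ, sub_self, map_zero]; exact zero_le⟩

/-- **THE ORBITS OF DISTINCT REPRESENTATIVES ARE DISJOINT** (`κ` mod `𝔭^ρ` is a lattice invariant at the corner `2ρ+1`, ★ `v_kappa_sub_le_of_latt_glued_corner_eq`, and `R` is
irredundant). [cite: Kottwitz1986BaseChangeUnits, §1 pp. 240–241] -/
theorem pairwise_disjoint_orbits_two {ϖ : K} (hϖ : Valued.v ϖ = WithZero.exp (-1 : ℤ)) (ρ : ℕ) {R : Set K} (hR1 : ∀ g ∈ R, Valued.v g = 1)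
    (hR3 : ∀ g ∈ R, ∀ g' ∈ R, Valued.v (g - g') ≤ Valued.v ϖ ^ ρ → g = g') :
    {g : K | g ∈ R ∧ Valued.v (1 + g) = 1}.PairwiseDisjoint (fun g : K =>
      {M : Submodule 𝒪[K] (Fin 3 → K) | ∃ u ∈ unitTorus K 3,
        M = mapGL (diagGLUnits u) (latt (!![1, 0, 0; 1, ϖ ^ ρ, 0; 1 * 1 + g, ϖ ^ ρ * 1, ϖ ^ (2 * ρ + 1)] : Matrix (Fin 3) (Fin 3) K))}) := by
  obtain ⟨hϖ0, hϖ1⟩ := ne_zero_and_v_lt_one_of_v_eq_exp hϖ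
  have hpρ : ϖ ^ ρ ≠ 0 := pow_ne_zero _ hϖ0
  have hpr : ϖ ^ (2 * ρ + 1) ≠ 0 := pow_ne_zero _ hϖ0
  intro g hg g' hg' hne
  rw [Function.onFun, Set.disjoint_left]
  rintro M ⟨u, hu, rfl⟩ ⟨u', hu', hM⟩
  apply hne
  obtain ⟨V₀, hV₀⟩ := exists_gl_coe_eq_glued (1 : K) 1 g hpρ hpr
  obtain ⟨V₀', hV₀'⟩ := exists_gl_coe_eq_glued (1 : K) 1 g' hpρ hpr
  obtain ⟨x₁, ζ₁, y₁, hx₁, hζ₁, hy₁, -, hκ₁, h₁⟩ := exists_coreHanging_of_mem_orbit u hu (hR1 _ hg.1) hg.2 (ϖ ^ ρ) (ϖ ^ (2 * ρ + 1)) V₀ hV₀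
  obtain ⟨x₂, ζ₂, y₂, hx₂, hζ₂, -, -, hκ₂, h₂⟩ := exists_coreHanging_of_mem_orbit u' hu' (hR1 _ hg'.1) hg'.2 (ϖ ^ ρ) (ϖ ^ (2 * ρ + 1)) V₀' hV₀'
  rw [← hV₀, ← hV₀', h₁, h₂] at hM
  have hM' : latt (!![1, 0, 0; x₁, ϖ ^ ρ, 0; x₁ * ζ₁ + y₁, ϖ ^ ρ * ζ₁, ϖ ^ (2 * ρ + 0 + 1)] : Matrix (Fin 3) (Fin 3) K) =
      latt (!![1, 0, 0; x₂, ϖ ^ ρ, 0; x₂ * ζ₂ + y₂, ϖ ^ ρ * ζ₂, ϖ ^ (2 * ρ + 0 + 1)] : Matrix (Fin 3) (Fin 3) K) := by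
    rw [Nat.add_zero]; exact hM
  have hk := v_kappa_sub_le_of_latt_glued_corner_eq hϖ0 hϖ1.le ρ 0 1 hx₁ hζ₁ (by rw [pow_zero]; exact hy₁) hx₂ hζ₂ hM'
  rw [hκ₁, hκ₂, Nat.add_zero] at hk
  exact hR3 _ hg.1 _ hg'.1 hk

/-- **EACH ORBIT CONTRIBUTES `[𝒯 : S̃]∕[𝒰 : S_F]` TO THE PLAIN WEIGHT SUM**: on the orbit `𝒯·latt V_H₂(1,1,g)` (`g` a `σ`-fixed unit) the weight is the constant
`(((q−1)q^{(ρ+2)∕2−1})·((q−1)q^ρ))⁻¹` (★ `stabiliserWeight_latt_glued_typeTwo_eq` at `s = 0` with `f := g`) and the orbit has `((q−1)q^ρ)((q−1)q^{2ρ})` members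
(★ `ncard_unitTorus_orbit_latt_glued_typeTwo_eq` at `s = 0`). [cite: Kottwitz1986BaseChangeUnits, §1 pp. 240–241] [cite: Rogawski1990, §4.9 Prop. 4.9.1 (a) p. 55] -/
theorem finsum_stabiliserWeight_orbit_two_eq {σ : K →+* K} (hσ : ∀ a, σ (σ a) = a) (hvσ : ∀ a, Valued.v (σ a) = Valued.v a)
    (hfix : ∀ x : K, σ x = x → x ≠ 0 → ∃ n : ℤ, Valued.v x = WithZero.exp (2 * n)) {ϖ : K} (hϖ : Valued.v ϖ = WithZero.exp (-1 : ℤ))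
    {d : ℕ} (hd : Valued.v (ϖ - σ ϖ) = Valued.v ϖ ^ d) [Finite 𝓀[K]] {ρ : ℕ} (hρ : 1 ≤ ρ) {g : K} (hσg : σ g = g) (hvg : Valued.v g = 1) :
    ∑ᶠ M ∈ {M : Submodule 𝒪[K] (Fin 3 → K) | ∃ u ∈ unitTorus K 3,
        M = mapGL (diagGLUnits u) (latt (!![1, 0, 0; 1, ϖ ^ ρ, 0; 1 * 1 + g, ϖ ^ ρ * 1, ϖ ^ (2 * ρ + 1)] : Matrix (Fin 3) (Fin 3) K))},
        stabiliserWeight σ M =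
      ((((Nat.card 𝓀[K] - 1) * Nat.card 𝓀[K] ^ ρ) * ((Nat.card 𝓀[K] - 1) * Nat.card 𝓀[K] ^ (2 * ρ)) : ℕ) : ℚ) *
        ((((Nat.card 𝓀[K] - 1) * Nat.card 𝓀[K] ^ ((ρ + 2) / 2 - 1)) * ((Nat.card 𝓀[K] - 1) * Nat.card 𝓀[K] ^ ρ) : ℕ) : ℚ)⁻¹ := by
  obtain ⟨hϖ0, hϖ1⟩ := ne_zero_and_v_lt_one_of_v_eq_exp hϖ
  have hq : 1 < Nat.card 𝓀[K] := Finite.one_lt_card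
  obtain ⟨V₀, hV₀⟩ := exists_gl_coe_eq_glued (1 : K) 1 g (pow_ne_zero ρ hϖ0) (pow_ne_zero (2 * ρ + 1) hϖ0)
  -- the orbit size (★ at `s = 0`)
  have hV0 : (V₀ : Matrix (Fin 3) (Fin 3) K) = !![1, 0, 0; 1, ϖ ^ ρ, 0; 1 * 1 + g, ϖ ^ ρ * 1, ϖ ^ (2 * ρ + 1 + 0)] := by rw [Nat.add_zero]; exact hV₀
  have hg0 : Valued.v g = Valued.v ϖ ^ 0 := by rw [pow_zero]; exact hvg
  have hcard := ncard_unitTorus_orbit_latt_glued_typeTwo_eq hϖ hρ 0 (map_one _) (map_one _) hg0 V₀ hV0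
  rw [Nat.add_zero] at hcard
  rw [← hV₀]
  have hfin : {M : Submodule 𝒪[K] (Fin 3 → K) | ∃ u ∈ unitTorus K 3, M = mapGL (diagGLUnits u) (latt (V₀ : Matrix (Fin 3) (Fin 3) K))}.Finite := by
    refine Set.finite_of_ncard_ne_zero ?_
    rw [hcard]
    exact mul_ne_zero (mul_ne_zero (by omega) (pow_ne_zero _ (by omega))) (mul_ne_zero (by omega) (pow_ne_zero _ (by omega)))
  rw [finsum_mem_eq_ncard_mul hfin _ _ ?_, hcard]
  rintro M ⟨u, -, rfl⟩
  rw [stabiliserWeight_mapGL_diagGLUnits]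
  have h := stabiliserWeight_latt_glued_typeTwo_eq hσ hvσ hfix hϖ hd hρ 0 (map_one _) (map_one _) hg0 V₀ hV0 hσg
    (by simp [hσg])
  rw [Nat.add_zero] at h
  exact h

/-- **THE MULTIPLICITY IS CONSTANT ON THE STRATUM**: every member of `𝒮_H₂(ρ)` has `polarisationCount σ ϖ 2 M = q^{(ρ+2)∕2 − (ρ+1)∕2}` ((iii)₂ (b) at its frame letters).
[cite: Kottwitz1986BaseChangeUnits, §1 pp. 240–241] -/
theorem polarisationCount_eq_of_mem_coreHangingTwoStratum {σ : K →+* K} {ϖ : K} {d : ℕ} (hσ : ∀ a, σ (σ a) = a) (hvσ : ∀ a, Valued.v (σ a) = Valued.v a)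
    (hfix : ∀ x : K, σ x = x → x ≠ 0 → ∃ n : ℤ, Valued.v x = WithZero.exp (2 * n)) (hϖ : Valued.v ϖ = WithZero.exp (-1 : ℤ))
    (hd : Valued.v (ϖ - σ ϖ) = Valued.v ϖ ^ d) (hTr : ∀ a : K, Valued.v (a + σ a) ≤ Valued.v ϖ * Valued.v a) [Finite 𝓀[K]]
    (T : GL (Fin 3) K) {ρ : ℕ} (hρ : 1 ≤ ρ) {M : Submodule 𝒪[K] (Fin 3 → K)}
    (hM : M ∈ {M : Submodule 𝒪[K] (Fin 3 → K) | M ∈ normalisedStableLattices T ∧ IsTypeTwoPolarisable σ ϖ M ∧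
        ∃ x ζ y'' : K, Valued.v x = 1 ∧ Valued.v ζ = 1 ∧ Valued.v y'' = 1 ∧ Valued.v (x * ζ + y'') = 1 ∧
          M = latt (!![1, 0, 0; x, ϖ ^ ρ, 0; x * ζ + y'', ϖ ^ ρ * ζ, ϖ ^ (2 * ρ + 1)] : Matrix (Fin 3) (Fin 3) K)}) :
    polarisationCount σ ϖ 2 M = Nat.card 𝓀[K] ^ ((ρ + 2) / 2 - (ρ + 1) / 2) := by
  obtain ⟨hϖ0, -⟩ := ne_zero_and_v_lt_one_of_v_eq_exp hϖ
  obtain ⟨-, hpol, x, ζ, y'', hx, hζ, hy'', hy, rfl⟩ := hM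
  obtain ⟨V, hV⟩ := exists_gl_coe_eq_glued x ζ y'' (pow_ne_zero ρ hϖ0) (pow_ne_zero (2 * ρ + 1) hϖ0)
  rw [← hV] at hpol ⊢
  exact polarisationCount_two_latt_coreHanging_eq_of_isTypeTwoPolarisable hσ hvσ hfix hϖ hd hTr ρ hρ hx hζ hy'' hy V hV hpol

/-! ## §2 HEAD — the tube-regime count with multiplicity -/

/-- **B7₂ (iv)₂, TUBE REGIME — THE n₂-WEIGHTED COUNT OF THE CORE-HANGING TYPE-2 STRATUM IS `(q − 2)·q^{2ρ}`.**  For the ramified quadratic datum letters `hσ hvσ hfix hϖ hd` with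
the wild trace bound `hTr`, a finite residue field (`q = #𝓀`), `T = diag(α, β, 1)` with unit entries and depths `|β − 1| = |ϖ|^{n₁}`, `|α − 1| = |ϖ|^{n₂}`, `|β − α| = |ϖ|^{n₃}`, and
`ρ ≥ 1` with `2ρ+1 ≤ n₁`, `2ρ+1 ≤ n₂`, `ρ ≤ n₃`: `∑ᶠ_{M ∈ 𝒮_H₂(ρ)} n₂(M)·stabiliserWeight σ M = (q − 2)·q^{2ρ}` (the tube summand of the re-keyed `stub_B7_H`; at `q = 2` both sides
are `0`; `n₂ ≡ q^{(ρ+2)∕2 − (ρ+1)∕2}` makes the two parities of `ρ` agree). [cite: Rogawski1990, §4.9 Prop. 4.9.1 (a) p. 55] [cite: Kottwitz1986BaseChangeUnits, §1 pp. 240–241] -/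
theorem finsum_polarisationCount_mul_stabiliserWeight_coreHangingTwoStratum_tube {σ : K →+* K} (hσ : ∀ a, σ (σ a) = a) (hvσ : ∀ a, Valued.v (σ a) = Valued.v a)
    (hfix : ∀ x : K, σ x = x → x ≠ 0 → ∃ n : ℤ, Valued.v x = WithZero.exp (2 * n)) {ϖ : K} (hϖ : Valued.v ϖ = WithZero.exp (-1 : ℤ))
    {d : ℕ} (hd : Valued.v (ϖ - σ ϖ) = Valued.v ϖ ^ d) (hTr : ∀ a : K, Valued.v (a + σ a) ≤ Valued.v ϖ * Valued.v a) [Finite 𝓀[K]]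
    (T : GL (Fin 3) K) {α β : K} (hT : (T : Matrix (Fin 3) (Fin 3) K) = Matrix.diagonal ![α, β, 1]) (hα : Valued.v α = 1) (hβ : Valued.v β = 1)
    {n₁ n₂ n₃ : ℕ} (h₁ : Valued.v (β - 1) = Valued.v ϖ ^ n₁) (h₂ : Valued.v (α - 1) = Valued.v ϖ ^ n₂) (h₃ : Valued.v (β - α) = Valued.v ϖ ^ n₃)
    {ρ : ℕ} (hρ : 1 ≤ ρ) (hρ₁ : 2 * ρ + 1 ≤ n₁) (hρ₂ : 2 * ρ + 1 ≤ n₂) (hρ₃ : ρ ≤ n₃) :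
    ∑ᶠ M ∈ {M : Submodule 𝒪[K] (Fin 3 → K) | M ∈ normalisedStableLattices T ∧ IsTypeTwoPolarisable σ ϖ M ∧
        ∃ x ζ y'' : K, Valued.v x = 1 ∧ Valued.v ζ = 1 ∧ Valued.v y'' = 1 ∧ Valued.v (x * ζ + y'') = 1 ∧
          M = latt (!![1, 0, 0; x, ϖ ^ ρ, 0; x * ζ + y'', ϖ ^ ρ * ζ, ϖ ^ (2 * ρ + 1)] : Matrix (Fin 3) (Fin 3) K)},
        (polarisationCount σ ϖ 2 M : ℚ) * stabiliserWeight σ M =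
      ((Nat.card 𝓀[K] : ℚ) - 2) * (Nat.card 𝓀[K] : ℚ) ^ (2 * ρ) := by
  obtain ⟨hϖ0, hϖ1⟩ := ne_zero_and_v_lt_one_of_v_eq_exp hϖ
  have hq : 1 < Nat.card 𝓀[K] := Finite.one_lt_card
  -- the multiplicity is constant on the stratum
  rw [finsum_mem_mul_eq_of_forall_eq (fun M => polarisationCount σ ϖ 2 M) (stabiliserWeight σ) (Nat.card 𝓀[K] ^ ((ρ + 2) / 2 - (ρ + 1) / 2))
    (fun M hM => polarisationCount_eq_of_mem_coreHangingTwoStratum hσ hvσ hfix hϖ hd hTr T hρ hM)]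
  -- representatives of the fixed units mod `𝔭^ρ` and the admissible ones (★ (B) of the type-0 chain)
  obtain ⟨R, hRfin, hRcard, hR1, hR2, hR3⟩ := exists_fixed_class_representatives hσ hvσ hfix hϖ hd ρ 0 hρ
  simp only [Nat.mul_zero, pow_zero, Nat.add_zero] at hR1 hR2 hR3
  have hadm := ncard_admissible_representatives_eq hσ hvσ hfix hϖ hd hρ hRfin hRcard hR1 hR2 hR3
  have hRadmfin : {g : K | g ∈ R ∧ Valued.v (1 + g) = 1}.Finite := hRfin.subset (Set.sep_subset _ _)
  -- decompose and sum orbit by orbit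
  rw [coreHangingTwoStratum_eq_iUnion_orbits hσ hvσ hϖ hTr T hT hα hβ h₁ h₂ h₃ hρ hρ₁ hρ₂ hρ₃ hR1 hR2,
    finsum_mem_biUnion (pairwise_disjoint_orbits_two hϖ ρ (fun g hg => (hR1 g hg).2) hR3) hRadmfin ?_]
  · rw [finsum_mem_eq_ncard_mul hRadmfin _ _ (fun g hg => finsum_stabiliserWeight_orbit_two_eq hσ hvσ hfix hϖ hd hρ (hR1 _ hg.1).1 (hR1 _ hg.1).2), hadm]
    -- arithmetic
    have hq1 : ((Nat.card 𝓀[K] : ℚ) - 1) ≠ 0 := by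
      have : (1 : ℚ) < Nat.card 𝓀[K] := by exact_mod_cast hq
      linarith
    have hq0 : (Nat.card 𝓀[K] : ℚ) ≠ 0 := by exact_mod_cast (by omega : Nat.card 𝓀[K] ≠ 0)
    rw [ceil_succ_exponent_eq hρ]
    set A : ℕ := (ρ + 1) / 2 - 1 with hA
    set C : ℕ := (ρ + 2) / 2 - (ρ + 1) / 2 with hC
    have e2 : 2 * ρ = ρ + ρ := by ring
    push_cast [Nat.cast_sub hq.le, Nat.cast_sub (show 2 ≤ Nat.card 𝓀[K] by omega)]
    rw [e2, pow_add, pow_add]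
    field_simp
  · intro g hg
    obtain ⟨V₀, hV₀⟩ := exists_gl_coe_eq_glued (1 : K) 1 g (pow_ne_zero ρ hϖ0) (pow_ne_zero (2 * ρ + 1) hϖ0)
    have hV0 : (V₀ : Matrix (Fin 3) (Fin 3) K) = !![1, 0, 0; 1, ϖ ^ ρ, 0; 1 * 1 + g, ϖ ^ ρ * 1, ϖ ^ (2 * ρ + 1 + 0)] := by rw [Nat.add_zero]; exact hV₀
    have hcard := ncard_unitTorus_orbit_latt_glued_typeTwo_eq hϖ hρ 0 (map_one _) (map_one _) (by rw [pow_zero]; exact (hR1 _ hg.1).2) V₀ hV0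
    rw [← hV₀]
    refine Set.finite_of_ncard_ne_zero ?_
    rw [hcard]
    exact mul_ne_zero (mul_ne_zero (by omega) (pow_ne_zero _ (by omega))) (mul_ne_zero (by omega) (pow_ne_zero _ (by omega)))

end Summit.HodgeConjecture.HodgeConjecture.Cruxes.H413.F0P3cDyRamDiagonalCoreHangingCountTypeTwo

end
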